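import Summits.ABC.IUTFork.Joshi.TestIsmScalingResults
import HarnessLib

/-!
# Block E, test X-07′ — adversary addendum: at the Joshi-style instantiation S is TRANSITIVE (holds for EVERY ball-valued datum)

AUTHORED BY abc-iut-E-cx (refuter seat refuter-abc-iut-E-cx-g0-0, block E adversary); proxy-filed VERBATIM by a prover hand per the
cell's PROXY RULE (plan/repair/REPAIR-SPEC.md §2). Record file of the abc-iut cell, branch E «type Joshi's construction, test vs S»
(rung LADDER-ABC:A2.E; TEST-LEDGER row X-07′, adversary sharpening of the S-REACHED clause). **No side is taken** on [IUTchIII]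
Cor. 3.12, on Joshi's claims (unrefereed arXiv preprints) or on Mochizuki's report on them; typed ≠ proved ≠ endorsed. PROOF-ONLY over
abc-iut-E-t41's `Joshi/TestIsmScaling*.lean` (p431238, p431588, p431886) and the harness (p428758): 0 new `def`, no `Prop` fact, no
instance, no `sorry`.

## What is located (a property of OUR typed S at OUR typed model, no judgement on print)
At E-t41's Joshi-style instantiation (`scalFull p`: the pinned data with `LogShells.ism := univ`; `scalSetting p`; operator
`scalRegion p`), S = `PilotKummerIndRelated` is reached for the q-pilot's Kummer datum (`IsmScaling.scalSetting_pilotKummerIndRelated`,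
p431886). THIS FILE records that the same S holds there for **every** datum `qK'` whose glued region is a ball `B_{k_j}` at each label
`j ∈ 𝔽_l^⋇` (`scalSetting_pilotKummerIndRelated_of_balls`): the (Ind2)-family `scaleFamily (p^{k_j − j²})` — an indeterminacy of the
Joshi-style shells exactly like `untiltFamily` (the case `k ≡ 1`) — carries the Θ-region `B_{j²}` onto `B_{k_j}`, label by label. So at
this model the enlargement of (Ind2) that REACHES the q-pilot reaches every ball-valued datum alike: the licence S, once valid, no longer
singles out the q-pilot (it is one instance of a transitive action of the valuation-rescalings on balls), and — the other face of the same
transitivity — the full (Ind1)(Ind2)-orbit of the Θ-region has no hull (`IsmScaling.scalSetting_not_hullDefined`, p431886). The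
q-pilot case `k ≡ 1` is recovered as `scalSetting_pilotKummerIndRelated_of_balls_qDatum` (= E-t41's theorem, by a different bookkeeping of
the same move). CONTRAST (model of record, `ism := {±1}`): there S holds for a ball-valued datum iff its regions are the Θ-regions
`B_{j²}` themselves (isometries move no ball), and fails for the q-pilot (`PinnedWitness.pinned_countermodel`). Located; interface level
over `toyIndex`; a model exhibits satisfiability of typed hypotheses, nothing more. [claim: Mochizuki2012, status: disputed]
[claim: Joshi2024ATS3, status: disputed]
-/

noncomputable section

open Set

namespace Summit.ABC.IUTFork.Joshi.IsmScaling

open Thm311 Cor312 Cor312.Checks Cor312.IdentifiedNonVacuity Cor312Vol Cor312Vol.NaiveWitness Cor312Vol.PinnedWitness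
  Literature.IUT.LogThetaLattice

variable (p : ℕ) [hp : Fact p.Prime]

/-- **The rescaling that carries `Θ` onto an ARBITRARY ball-vector.** For every datum `qK'` whose glued region at each nonzero label `j`
is the ball `B_{k_j}`, the (Ind2)-family `scaleFamily (j ↦ p^{k_j − j²})` lies in `⟨(Ind1) ∪ (Ind2)⟩` of the Joshi-style shells and
carries the column Θ-datum region (`B_{j²}` at `j ≠ 0`, `univ` at `0`) ONTO the region of `qK'` — i.e. `UntiltChangeIsInd ∧
UntiltChangeCarriesQ` for `qK'` (abc-iut-E-cx's reading predicates, TestHarness p428758). [folklore] -/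
theorem scalSetting_untiltChange_of_balls (qK' : ∀ v : toyIndex.V, v ∈ toyIndex.Vbad → Set (signShells.StarPacket v))
    (k : toyIndex.Label → ℤ) (hq : ∀ j : toyIndex.Label, j ≠ 0 → ∀ vQ : toyIndex.VQ, scalRegion p qK' j vQ = pBall p j vQ (k j)) :
    UntiltChangeIsInd (scalFull p).toLatticeSituation (fun _ => scaleFamily fun j => ppowUnit p (k j - jsq j)) ∧
      UntiltChangeCarriesQ (scalFull p).toLatticeSituation (scalSetting p) (scalRegion p) qK'
        fun _ => scaleFamily fun j => ppowUnit p (k j - jsq j) := by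
  refine ⟨fun _ => scaleFamily_mem_closure _, fun j vQ => ⟨0, ?_⟩⟩
  rw [scalFull_frobΨ, scalRegion_Psi]
  by_cases hj : j = 0
  · subst hj
    rw [scalRegion_zero, if_pos rfl]
    exact (Set.image_univ_of_surjective (scaleFamily (fun j => ppowUnit p (k j - jsq j)) 0 vQ).surjective).symm
  · rw [hq j hj vQ, if_neg hj, image_pBall_scaleFamily]
    show pBall p j vQ (k j) = pBall p j vQ (jsq j + padicValRat p ((p : ℚ) ^ (k j - jsq j)))
    rw [padicValRat_ppow, add_sub_cancel]

/-- **S IS TRANSITIVE at the Joshi-style instantiation**: `PilotKummerIndRelated` holds for EVERY datum whose glued region is a ball at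
each label of `𝔽_l^⋇` — through the same template as the q-pilot case (`Joshi.pilotKummerIndRelated_of_untiltChange`: Thm. 3.11 (ii)(b)
for the column + (hρ) + the explicit (Ind2)-family). [claim: Mochizuki2012, status: disputed] -/
theorem scalSetting_pilotKummerIndRelated_of_balls (qK' : ∀ v : toyIndex.V, v ∈ toyIndex.Vbad → Set (signShells.StarPacket v))
    (k : toyIndex.Label → ℤ) (hq : ∀ j : toyIndex.Label, j ≠ 0 → ∀ vQ : toyIndex.VQ, scalRegion p qK' j vQ = pBall p j vQ (k j)) :
    PilotKummerIndRelated (scalFull p).toLatticeSituation (scalSetting p) (scalRegion p) qK' :=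
  pilotKummerIndRelated_of_untiltChange (scal_partII p (scalSetting p).n).2.1 (scalSetting_thetaPinned p).1
    (scalSetting_untiltChange_of_balls p qK' k hq).1 (scalSetting_untiltChange_of_balls p qK' k hq).2

/-- The q-pilot case `k ≡ 1` (`B_1 = q·𝒪` at every `j ≠ 0`, `IsmScaling.scalRegion_qDatum`): E-t41's `scalSetting_pilotKummerIndRelated`
recovered as ONE instance of the transitive statement. [claim: Mochizuki2012, status: disputed] -/
theorem scalSetting_pilotKummerIndRelated_of_balls_qDatum :
    PilotKummerIndRelated (scalFull p).toLatticeSituation (scalSetting p) (scalRegion p) (qDatum p) :=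
  scalSetting_pilotKummerIndRelated_of_balls p (qDatum p) (fun _ => 1) fun _ hj vQ => by
    rw [scalRegion_qDatum p hj vQ]

/-- **Every ball-vector OCCURS**: the (Ind)-translate `scaleFamily u · Ψ_v` of the Θ-datum has glued region `B_{j² + v_p(u_j)}` at
`j ≠ 0` (`scalRegion_equivariant` + `image_pBall_scaleFamily`), so the class of data covered by `scalSetting_pilotKummerIndRelated_of_balls`
realises every `k : 𝔽_l → ℤ` (take `u_j = p^{k_j − j²}`); S holds for all of them. [folklore] -/
theorem scalRegion_translate_Psi (u : toyIndex.Label → ℚˣ) {j : toyIndex.Label} (hj : j ≠ 0) (vQ : toyIndex.VQ) :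
    scalRegion p (fun v _ => signShells.starAut (scaleFamily u) v '' Psi p v) j vQ =
      pBall p j vQ (jsq j + padicValRat p (u j : ℚ)) := by
  rw [scalRegion_equivariant, scalRegion_Psi, if_neg hj]
  exact image_pBall_scaleFamily p u j vQ (jsq j)

/-- … in particular S holds for every (Ind)-translate of the Θ-datum by a valuation-rescaling (all ball-vectors `B_{j²+v_p(u_j)}`).
[claim: Mochizuki2012, status: disputed] -/
theorem scalSetting_pilotKummerIndRelated_translate (u : toyIndex.Label → ℚˣ) :
    PilotKummerIndRelated (scalFull p).toLatticeSituation (scalSetting p) (scalRegion p)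
      fun v _ => signShells.starAut (scaleFamily u) v '' Psi p v :=
  scalSetting_pilotKummerIndRelated_of_balls p _ (fun j => jsq j + padicValRat p (u j : ℚ)) fun _ hj vQ =>
    scalRegion_translate_Psi p u hj vQ

end Summit.ABC.IUTFork.Joshi.IsmScaling

end
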